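import Mathlib
import HarnessLib
import Summits.AtomisticToContinuum.FouriersLaw.Theses.JunctionLocality
import Summits.AtomisticToContinuum.FouriersLaw.Theorems.JunctionLocalityDefs
import Summits.AtomisticToContinuum.FouriersLaw.Theorems.JunctionLocalityConductanceLowerBoundStubEscapeFloorAux1
import Summits.AtomisticToContinuum.FouriersLaw.Theorems.BondHeatUncertaintySubdiffusiveBondHeatBathBondReductionDynkin
import Summits.AtomisticToContinuum.FouriersLaw.Theorems.PhononMeanFreePathIncoherentBoundedGrowthDynkin
import Summits.AtomisticToContinuum.FouriersLaw.Theorems.BondHeatUncertaintyLinearResponseFTURSteadyHeatRatesHelper3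

/-!
# Short-time dipole floor, helper 2: the damped integral equation of the kick pairing (fixed `N`)

Helper (`--supports stmt-AtomisticToContinuum-11749`) for stub `stub_shortTimeDipoleFloor` (S) of line
`kick-dipole-no-collapse`, crux `JunctionLocality.ConductanceLowerBound`.

Fixed-`N` kernel bookkeeping for the pinned anharmonic chain `P = pinnedChain ω₂ lam β γ` (all parameters `> 0`), `T > 0`,
`N ≥ 2`, equal-temperature kernels `κ_s` (`evolve`), Gibbs measure `μ_T`, total current `J = totalCurrentObs`, contact kinetic
energy `e₀ = p_0²/2` and the CONTACT POWER `a₀ = p_0 ∂_{q_0}H`: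

* `evolve` of the exponential-class observables `e₀`, `a₀` and its `L²(μ_T)` bookkeeping (`contactObs_facts`);
* `kickKernel_eq_pairing_kin` — `𝒥_N(s) = −(2γ/T²) ψ(s)`, `ψ(s) = ∫ J · (κ_s e₀) dμ_T` (reflection halving + detailed balance,
  `helper_kdKickKernelRegression`);
* `pairing_kin_dynkin` — Dynkin's identity for `e₀` (`L e₀ = −a₀ + γ(T − p_0²)`, `IncoherentBounded.pinnedChain_dynkin_of_growth`)
  integrated against `J` (`SubdiffusiveBondHeat.pinnedChain_integral_mul_act_sub_of_dynkin`) and the odd detailed balance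
  `∫ J·κ_s a₀ = ∫ a₀·κ_s J`: the damped integral equation `ψ(r) = ∫₀ʳ (−Φ(s) − 2γ ψ(s)) ds` with the CONTACT POWER PAIRING
  `Φ(s) = ∫ a₀ · (κ_s J) dμ_T`.
-/

noncomputable section

open MeasureTheory ProbabilityTheory Filter Topology Set
open scoped NNReal ENNReal BigOperators
open Literature.MathematicalPhysics.KineticTheory.HeatConduction
open Summit.AtomisticToContinuum.FouriersLaw.Theorems.JunctionLocality
open Summit.AtomisticToContinuum.FouriersLaw.Theorems
open Summit.AtomisticToContinuum.FouriersLaw.Theorems.SubdiffusiveBondHeat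

namespace Summit.AtomisticToContinuum.FouriersLaw.Cruxes.ConductanceLowerBound.KickDipoleNoCollapse

variable {N : ℕ}

section Pinned

variable {ω₂ lam β γ : ℝ} (hω : 0 < ω₂) (hl : 0 < lam) (hβ : 0 < β) (hγ : 0 < γ) (hN : 0 < N) {T : ℝ} (hT : 0 < T)
include hω hl hβ hγ hN hT

/-- **Exponential-class bookkeeping.** For a continuous `f` with `|f| ≤ C e^{H/(4T)}`: `f` is integrable against every
kernel `κ_s(z, ·)`; `f², (κ_s f)² ∈ L¹(μ_T)`; and `J · (κ_s f)`, `f · (κ_s J)` are `μ_T`-integrable. -/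
theorem expClass_facts {f : PhaseSpace N → ℝ} (hfc : Continuous f) {C : ℝ}
    (hfb : ∀ y, |f y| ≤ C * Real.exp (1 / (4 * T) * (pinnedChain ω₂ lam β γ).hamiltonian N y)) (s : ℝ) :
    (∀ z, Integrable f ((pinnedChain ω₂ lam β γ).transitionKernel N T T s.toNNReal z)) ∧
    Integrable (fun z => f z ^ 2) ((pinnedChain ω₂ lam β γ).gibbsMeasure N T) ∧
    Integrable (fun z => (evolve (pinnedChain ω₂ lam β γ) N T f s z) ^ 2) ((pinnedChain ω₂ lam β γ).gibbsMeasure N T) ∧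
    Integrable (fun z => totalCurrentObs (pinnedChain ω₂ lam β γ) N z * evolve (pinnedChain ω₂ lam β γ) N T f s z)
      ((pinnedChain ω₂ lam β γ).gibbsMeasure N T) ∧
    Integrable (fun z => f z * evolve (pinnedChain ω₂ lam β γ) N T (totalCurrentObs (pinnedChain ω₂ lam β γ) N) s z)
      ((pinnedChain ω₂ lam β γ).gibbsMeasure N T) := by
  set P := pinnedChain ω₂ lam β γ with hP
  obtain ⟨hϑ0, h2ϑ⟩ := LightConeBondHeat.quarter_inv_temp_admissible hT
  have hϑ1 : 1 / (4 * T) < 1 / T := one_div_lt_one_div_of_lt hT (by linarith)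
  have h1 : ∀ z, Integrable f (P.transitionKernel N T T s.toNNReal z) := fun z =>
    integrable_of_abs_le_exp
      (pinnedChain_integrable_exp_mul_hamiltonian_transitionKernel hω hl.le hT hβ.le hγ.le hN hϑ0 hϑ1
        s.toNNReal z) hfc hfb
  obtain ⟨hf2, hPf2, -⟩ := pinnedChain_integral_sq_act_le hω hl.le hβ hγ hN hT hϑ0 h2ϑ hfc hfb s.toNNReal
  obtain ⟨hJm, hPJ2, -, -, hJ2⟩ := evolve_totalCurrentObs_facts hω hl hβ hγ hN hT s
  have hJc : Continuous (totalCurrentObs P N) := OddSectorIrreversibility.continuous_totalBondCurrent ω₂ lam β γ N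
  have hPfm : StronglyMeasurable (evolve P N T f s) :=
    hfc.stronglyMeasurable.integral_kernel (κ := P.transitionKernel N T T s.toNNReal)
  refine ⟨h1, hf2, hPf2, ?_, ?_⟩
  · exact integrable_mul_of_sq_aesm hJc.aestronglyMeasurable hPfm.aestronglyMeasurable hJ2 hPf2
  · exact integrable_mul_of_sq_aesm hfc.aestronglyMeasurable hJm.aestronglyMeasurable hf2 hPJ2

/-- The contact kinetic energy `e₀ = p_0²/2` and the contact power `a₀ = p_0 ∂_{q_0}H` are continuous of exponential class
`|·| ≤ C e^{H/(4T)}`, `e₀` is even and `a₀` is odd under the momentum flip. -/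
theorem contactObs_facts :
    ∃ C : ℝ, 0 ≤ C ∧
    (Continuous fun z : PhaseSpace N => z.2 ⟨0, hN⟩ ^ 2 / 2) ∧
    (∀ y : PhaseSpace N, |y.2 ⟨0, hN⟩ ^ 2 / 2| ≤ C * Real.exp (1 / (4 * T) * (pinnedChain ω₂ lam β γ).hamiltonian N y)) ∧
    (Continuous fun z : PhaseSpace N => z.2 ⟨0, hN⟩ * partialQ ⟨0, hN⟩ ((pinnedChain ω₂ lam β γ).hamiltonian N) z) ∧
    (∀ y : PhaseSpace N, |y.2 ⟨0, hN⟩ * partialQ ⟨0, hN⟩ ((pinnedChain ω₂ lam β γ).hamiltonian N) y| ≤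
      C * Real.exp (1 / (4 * T) * (pinnedChain ω₂ lam β γ).hamiltonian N y)) ∧
    (Continuous fun z : PhaseSpace N => (pinnedChain ω₂ lam β γ).generator N T T (fun y : PhaseSpace N => y.2 ⟨0, hN⟩ ^ 2 / 2) z) ∧
    (∀ y : PhaseSpace N, |(pinnedChain ω₂ lam β γ).generator N T T (fun y : PhaseSpace N => y.2 ⟨0, hN⟩ ^ 2 / 2) y| ≤
      C * Real.exp (1 / (4 * T) * (pinnedChain ω₂ lam β γ).hamiltonian N y)) := by
  set P := pinnedChain ω₂ lam β γ with hP
  obtain ⟨hϑ0, -⟩ := LightConeBondHeat.quarter_inv_temp_admissible hT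
  obtain ⟨C₁, hk, hLk, -⟩ := LinearResponseFTUR.pinnedChain_elementaryBounds ω₂ lam β γ hω hl.le hβ.le hγ.le N T T
  have hconf := pinnedChain_isConfining hω hl.le hβ.le hγ.le
  obtain ⟨A, hA0, hA⟩ := hconf.exists_abs_deriv_U_le
  obtain ⟨B, hB0, hB⟩ := hconf.exists_abs_deriv_V_le
  have hH1 : ContDiff ℝ 1 (P.hamiltonian N) := pinnedChain_contDiff_hamiltonian ω₂ lam β γ N
  have hQc : Continuous (partialQ ⟨0, hN⟩ (P.hamiltonian N)) := P.continuous_partialQ_hamiltonian hH1 _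
  set C₀ : ℝ := 2 * Real.exp (1 / (4 * T)) / (1 / (4 * T)) ^ 2 with hC₀
  have hC₀0 : 0 ≤ C₀ := by positivity
  have hsq : ∀ y, (1 + P.hamiltonian N y) ^ 2 ≤ C₀ * Real.exp (1 / (4 * T) * P.hamiltonian N y) := fun y =>
    one_add_sq_le_exp (pinnedChain_hamiltonian_nonneg hω.le hl.le hβ.le γ N y) hϑ0
  -- `C₁ ≥ 0` from the kinetic bound at any point
  have hC₁ : 0 ≤ C₁ := by
    have h := hk ⟨0, hN⟩ (0 : PhaseSpace N)
    have hpos : 0 < (1 + P.hamiltonian N 0) ^ 2 := by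
      have := pinnedChain_hamiltonian_nonneg hω.le hl.le hβ.le γ N (0 : PhaseSpace N); positivity
    exact nonneg_of_mul_nonneg_left ((abs_nonneg _).trans h) hpos
  set K : ℝ := A + N ^ 2 * B with hK
  have hK0 : 0 ≤ K := by positivity
  refine ⟨(C₁ + K) * C₀, by positivity, by fun_prop, fun y => ?_, ?_, fun y => ?_, ?_, fun y => ?_⟩
  · calc |y.2 ⟨0, hN⟩ ^ 2 / 2| ≤ C₁ * (1 + P.hamiltonian N y) ^ 2 := hk _ y
      _ ≤ (C₁ + K) * (1 + P.hamiltonian N y) ^ 2 := by gcongr; linarith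
      _ ≤ (C₁ + K) * (C₀ * Real.exp (1 / (4 * T) * P.hamiltonian N y)) := by gcongr; exact hsq y
      _ = _ := by ring
  · exact (by fun_prop : Continuous fun z : PhaseSpace N => z.2 ⟨0, hN⟩).mul hQc
  · have hp := LinearResponseFTUR.abs_momentum_le_one_add hconf.U_nonneg hconf.V_nonneg y ⟨0, hN⟩
    have hF := LinearResponseFTUR.abs_partialQ_hamiltonian_le hconf.U_nonneg hconf.V_nonneg hA0 hB0 hA hB
      hconf.differentiable_U hconf.differentiable_V y ⟨0, hN⟩
    have hH := pinnedChain_hamiltonian_nonneg hω.le hl.le hβ.le γ N y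
    rw [abs_mul]
    calc |y.2 ⟨0, hN⟩| * |partialQ ⟨0, hN⟩ (P.hamiltonian N) y| ≤ (1 + P.hamiltonian N y) * (K * (1 + P.hamiltonian N y)) :=
          mul_le_mul hp hF (abs_nonneg _) (by positivity)
      _ = K * (1 + P.hamiltonian N y) ^ 2 := by ring
      _ ≤ (C₁ + K) * (1 + P.hamiltonian N y) ^ 2 := by gcongr; linarith
      _ ≤ (C₁ + K) * (C₀ * Real.exp (1 / (4 * T) * P.hamiltonian N y)) := by gcongr; exact hsq y
      _ = _ := by ring
  · have e : (fun z : PhaseSpace N => P.generator N T T (fun y : PhaseSpace N => y.2 ⟨0, hN⟩ ^ 2 / 2) z) =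
        fun z : PhaseSpace N => -(z.2 ⟨0, hN⟩ * partialQ ⟨0, hN⟩ (P.hamiltonian N) z) +
          P.γ * ((if (⟨0, hN⟩ : Fin N).val = 0 then T - z.2 ⟨0, hN⟩ ^ 2 else 0) +
            (if (⟨0, hN⟩ : Fin N).val = N - 1 then T - z.2 ⟨0, hN⟩ ^ 2 else 0)) :=
      funext fun z => LinearResponseFTUR.generator_kinetic P T T ⟨0, hN⟩ z
    rw [e]
    refine (((by fun_prop : Continuous fun z : PhaseSpace N => z.2 ⟨0, hN⟩).mul hQc).neg).add (continuous_const.mul ?_)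
    refine Continuous.add ?_ ?_ <;> split_ifs <;> fun_prop
  · calc _ ≤ C₁ * (1 + P.hamiltonian N y) ^ 2 := hLk _ y
      _ ≤ (C₁ + K) * (1 + P.hamiltonian N y) ^ 2 := by gcongr; linarith
      _ ≤ (C₁ + K) * (C₀ * Real.exp (1 / (4 * T) * P.hamiltonian N y)) := by gcongr; exact hsq y
      _ = _ := by ring

/-- **Detailed balance for an odd source against the odd current**: for a measurable, momentum-odd `f` with
`f² ∈ L¹(μ_T)`, `∫ f · (κ_s J) dμ_T = ∫ J · (κ_s f) dμ_T`. -/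
theorem integral_odd_mul_evolve_totalCurrentObs {f : PhaseSpace N → ℝ} (hfm : Measurable f)
    (hfo : ∀ z : PhaseSpace N, f (z.1, -z.2) = -f z)
    (hf2 : Integrable (fun z => f z ^ 2) ((pinnedChain ω₂ lam β γ).gibbsMeasure N T)) (s : ℝ) :
    ∫ z, f z * evolve (pinnedChain ω₂ lam β γ) N T (totalCurrentObs (pinnedChain ω₂ lam β γ) N) s z
        ∂((pinnedChain ω₂ lam β γ).gibbsMeasure N T) =
      ∫ z, totalCurrentObs (pinnedChain ω₂ lam β γ) N z * evolve (pinnedChain ω₂ lam β γ) N T f s z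
        ∂((pinnedChain ω₂ lam β γ).gibbsMeasure N T) := by
  set P := pinnedChain ω₂ lam β γ with hP
  obtain ⟨-, -, -, -, hJ2⟩ := evolve_totalCurrentObs_facts hω hl hβ hγ hN hT s
  have hJm : Measurable (totalCurrentObs P N) := (OddSectorIrreversibility.continuous_totalBondCurrent ω₂ lam β γ N).measurable
  have hdb := pinnedChain_detailedBalance hω hl hβ hγ hN hT hfm hJm hf2 hJ2 s.toNNReal
  have h1 : ∫ z, f z * evolve P N T (totalCurrentObs P N) s z ∂(P.gibbsMeasure N T) =
      ∫ z, f z * (∫ y, totalCurrentObs P N y ∂(P.transitionKernel N T T s.toNNReal z)) ∂(P.gibbsMeasure N T) := rfl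
  rw [h1, hdb]
  refine integral_congr_ae (Eventually.of_forall fun z => ?_)
  dsimp only
  rw [totalCurrentObs_neg_momentum]
  simp only [hfo]
  rw [integral_neg, evolve_def]
  ring

/-- **The kick-response kernel through the contact kinetic energy**: for `N ≥ 1` and every real `s`,
`𝒥_N(s) = −(2γ/T²) ∫ J · κ_s(p_0²/2) dμ_T` (reflection halving, kernel detailed balance, `κ_s 1 = 1`, `∫ J dμ_T = 0`). -/
theorem kickKernel_eq_pairing_kin (s : ℝ) :
    kickKernel (pinnedChain ω₂ lam β γ) N T s =
      -(2 * γ / T ^ 2) * ∫ z, totalCurrentObs (pinnedChain ω₂ lam β γ) N z *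
        evolve (pinnedChain ω₂ lam β γ) N T (fun y : PhaseSpace N => y.2 ⟨0, hN⟩ ^ 2 / 2) s z
        ∂((pinnedChain ω₂ lam β γ).gibbsMeasure N T) := by
  set P := pinnedChain ω₂ lam β γ with hP
  obtain ⟨-, h2⟩ := helper_kdKickKernelRegression ω₂ lam β γ hω hl hβ hγ T hT N hN s
  obtain ⟨C, -, hec, heb, -⟩ := contactObs_facts hω hl hβ hγ hN hT
  obtain ⟨he1, -, -, hJe, -⟩ := expClass_facts hω hl hβ hγ hN hT hec heb s
  obtain ⟨-, -, hJi, hJ0, -⟩ := evolve_totalCurrentObs_facts hω hl hβ hγ hN hT 0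
  haveI : IsMarkovKernel (P.transitionKernel N T T s.toNNReal) :=
    pinnedChain_isMarkovKernel_transitionKernel hω hl.le hβ.le hγ.le N T T _
  -- `κ_s (p_0² − T) = 2 κ_s e₀ − T` pointwise
  have hpt : ∀ z, evolve P N T (fun y : PhaseSpace N => y.2 ⟨0, hN⟩ ^ 2 - T) s z =
      2 * evolve P N T (fun y : PhaseSpace N => y.2 ⟨0, hN⟩ ^ 2 / 2) s z - T := by
    intro z
    rw [evolve_def, evolve_def]
    have e1 : (fun y : PhaseSpace N => y.2 ⟨0, hN⟩ ^ 2 - T) = fun y => 2 * (y.2 ⟨0, hN⟩ ^ 2 / 2) - T := by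
      funext y; ring
    rw [e1, integral_sub ((he1 z).const_mul 2) (integrable_const T), integral_const_mul, integral_const]
    simp [hP]
  -- `J` at time `0`: `evolve … 0 = J`, so `∫ J dμ_T = 0` and `J ∈ L¹`
  have hJ0' : ∫ z, totalCurrentObs P N z ∂(P.gibbsMeasure N T) = 0 := by
    have e : evolve P N T (totalCurrentObs P N) 0 = totalCurrentObs P N :=
      funext fun z => pinnedChain_evolve_of_nonpos hω hl.le hβ.le hγ.le N T _ le_rfl z
    rw [e] at hJ0; exact hJ0
  have hJi' : Integrable (totalCurrentObs P N) (P.gibbsMeasure N T) := by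
    have e : evolve P N T (totalCurrentObs P N) 0 = totalCurrentObs P N :=
      funext fun z => pinnedChain_evolve_of_nonpos hω hl.le hβ.le hγ.le N T _ le_rfl z
    rw [e] at hJi; exact hJi
  rw [h2, integral_congr_ae (Eventually.of_forall fun z => congrArg (fun w => totalCurrentObs P N z * w) (hpt z))]
  have e2 : ∀ z, totalCurrentObs P N z * (2 * evolve P N T (fun y : PhaseSpace N => y.2 ⟨0, hN⟩ ^ 2 / 2) s z - T) =
      2 * (totalCurrentObs P N z * evolve P N T (fun y : PhaseSpace N => y.2 ⟨0, hN⟩ ^ 2 / 2) s z) -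
        T * totalCurrentObs P N z := fun z => by ring
  rw [integral_congr_ae (Eventually.of_forall e2), integral_sub (hJe.const_mul 2) (hJi'.const_mul T),
    integral_const_mul, integral_const_mul, hJ0']
  ring

/-- **The damped integral equation of the kinetic kick pairing** (`N ≥ 2`).  With `ψ(s) = ∫ J · κ_s(p_0²/2) dμ_T` and the
contact power pairing `Φ(s) = ∫ (p_0 ∂_{q_0}H) · (κ_s J) dμ_T`: for every `r ≥ 0`,
`ψ(r) = ∫₀ʳ (−Φ(s) − 2γ ψ(s)) ds` — Dynkin's identity for `e₀ = p_0²/2` (`L e₀ = −p_0∂_{q_0}H + γ(T − p_0²)`) integrated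
against `J`, `∫ J e₀ dμ_T = 0` by parity, and the odd detailed balance `∫ J · κ_s a₀ = ∫ a₀ · κ_s J`. -/
theorem pairing_kin_dynkin (hN2 : 2 ≤ N) {r : ℝ} (hr : 0 ≤ r) :
    ∫ z, totalCurrentObs (pinnedChain ω₂ lam β γ) N z *
        evolve (pinnedChain ω₂ lam β γ) N T (fun y : PhaseSpace N => y.2 ⟨0, hN⟩ ^ 2 / 2) r z
        ∂((pinnedChain ω₂ lam β γ).gibbsMeasure N T) =
      ∫ s in (0:ℝ)..r, (-(∫ z, (z.2 ⟨0, hN⟩ * partialQ ⟨0, hN⟩ ((pinnedChain ω₂ lam β γ).hamiltonian N) z) *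
          evolve (pinnedChain ω₂ lam β γ) N T (totalCurrentObs (pinnedChain ω₂ lam β γ) N) s z
          ∂((pinnedChain ω₂ lam β γ).gibbsMeasure N T)) -
        2 * γ * ∫ z, totalCurrentObs (pinnedChain ω₂ lam β γ) N z *
          evolve (pinnedChain ω₂ lam β γ) N T (fun y : PhaseSpace N => y.2 ⟨0, hN⟩ ^ 2 / 2) s z
          ∂((pinnedChain ω₂ lam β γ).gibbsMeasure N T)) := by
  set P := pinnedChain ω₂ lam β γ with hP
  set e₀ : PhaseSpace N → ℝ := fun y => y.2 ⟨0, hN⟩ ^ 2 / 2 with he₀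
  set a₀ : PhaseSpace N → ℝ := fun y => y.2 ⟨0, hN⟩ * partialQ ⟨0, hN⟩ (P.hamiltonian N) y with ha₀
  set ℓ₀ : PhaseSpace N → ℝ := fun y => P.generator N T T e₀ y with hℓ₀
  haveI : IsProbabilityMeasure (P.gibbsMeasure N T) := pinnedChain_isProbabilityMeasure_gibbsMeasure hω hl.le hβ.le γ N hT
  obtain ⟨C, hC0, hec, heb, hac, hab, hℓc, hℓb⟩ := contactObs_facts hω hl hβ hγ hN hT
  have hconf := pinnedChain_isConfining hω hl.le hβ.le hγ.le
  have hJc : Continuous (totalCurrentObs P N) := OddSectorIrreversibility.continuous_totalBondCurrent ω₂ lam β γ N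
  -- pointwise Dynkin for `e₀`
  obtain ⟨C₁, hk, hLk, -⟩ := LinearResponseFTUR.pinnedChain_elementaryBounds ω₂ lam β γ hω hl.le hβ.le hγ.le N T T
  have hC₁ : 0 ≤ C₁ := by
    have h := hk ⟨0, hN⟩ (0 : PhaseSpace N)
    have hpos : 0 < (1 + P.hamiltonian N 0) ^ 2 := by
      have := pinnedChain_hamiltonian_nonneg hω.le hl.le hβ.le γ N (0 : PhaseSpace N); positivity
    exact nonneg_of_mul_nonneg_left ((abs_nonneg _).trans h) hpos
  have hNlast : (⟨N - 1, Nat.sub_lt hN one_pos⟩ : Fin N) ≠ ⟨0, hN⟩ := by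
    intro h; have := congrArg Fin.val h; simp at this; omega
  have hdyn : ∀ (ρ : ℝ≥0) (z : PhaseSpace N), ∫ y, e₀ y ∂(P.transitionKernel N T T ρ z) - e₀ z =
      ∫ s in (0:ℝ)..(ρ : ℝ), ∫ y, ℓ₀ y ∂(P.transitionKernel N T T s.toNNReal z) := by
    intro ρ z
    refine IncoherentBounded.pinnedChain_dynkin_of_growth hω hl.le hβ hγ hN hT (e := e₀) (ℓ := ℓ₀) (by fun_prop)
      (fun x => by positivity) (fun x => ?_) (fun x => ?_) (fun x => ?_) (fun x => rfl) hC₁ (fun y => hLk _ y) ρ z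
    · have h := P.site_le_hamiltonian hconf.U_nonneg hconf.V_nonneg N x ⟨0, hN⟩
      have hU := hconf.U_nonneg (x.1 ⟨0, hN⟩)
      show x.2 ⟨0, hN⟩ ^ 2 / 2 ≤ P.hamiltonian N x
      linarith
    · rw [he₀, LinearResponseFTUR.partialP_kinetic, if_pos rfl]
    · rw [he₀, LinearResponseFTUR.partialP_kinetic, if_neg hNlast, abs_zero]
      exact abs_nonneg _
  -- Dynkin integrated against `J`
  obtain ⟨-, he2, -, -, -⟩ := expClass_facts hω hl hβ hγ hN hT hec heb 0
  obtain ⟨-, hℓ2, -, -, -⟩ := expClass_facts hω hl hβ hγ hN hT hℓc hℓb 0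
  obtain ⟨-, -, -, -, hJ2⟩ := evolve_totalCurrentObs_facts hω hl hβ hγ hN hT 0
  have hinv : ∀ s : ℝ≥0, (P.gibbsMeasure N T).bind (P.transitionKernel N T T s) = P.gibbsMeasure N T := fun s =>
    pinnedChain_gibbsMeasure_bind_transitionKernel hω hl.le hβ.le hγ.le hN hT s
  have H := pinnedChain_integral_mul_act_sub_of_dynkin hω hl.le hβ.le hγ.le N T T (P.gibbsMeasure N T) hinv
    hJc.measurable hec.measurable hℓc.measurable hJ2 he2 hℓ2 hdyn hr
  -- `∫ J e₀ dμ_T = 0` (parity: at time `0` the even/odd detailed balance reads `∫ e₀ J = −∫ J e₀`)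
  have hpar : ∫ z, totalCurrentObs P N z * e₀ z ∂(P.gibbsMeasure N T) = 0 := by
    have h := integral_even_mul_evolve_totalCurrentObs hω hl hβ hγ hN hT hec.measurable
      (fun z => by simp) he2 0
    have e1 : ∀ z, e₀ z * evolve P N T (totalCurrentObs P N) 0 z = totalCurrentObs P N z * e₀ z := fun z => by
      rw [pinnedChain_evolve_of_nonpos hω hl.le hβ.le hγ.le N T _ le_rfl z]; ring
    have e2 : ∀ z, totalCurrentObs P N z * evolve P N T e₀ 0 z = totalCurrentObs P N z * e₀ z := fun z => by
      rw [pinnedChain_evolve_of_nonpos hω hl.le hβ.le hγ.le N T _ le_rfl z]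
    rw [integral_congr_ae (Eventually.of_forall e1), integral_congr_ae (Eventually.of_forall e2)] at h
    linarith
  -- the integrand: `∫ J · κ_s ℓ₀ dμ_T = −Φ(s) − 2γ ψ(s)`
  have hint : ∀ s : ℝ, ∫ z, totalCurrentObs P N z * (∫ y, ℓ₀ y ∂(P.transitionKernel N T T s.toNNReal z)) ∂(P.gibbsMeasure N T) =
      -(∫ z, a₀ z * evolve P N T (totalCurrentObs P N) s z ∂(P.gibbsMeasure N T)) -
        2 * γ * ∫ z, totalCurrentObs P N z * evolve P N T e₀ s z ∂(P.gibbsMeasure N T) := by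
    intro s
    obtain ⟨he1, -, -, hJe, -⟩ := expClass_facts hω hl hβ hγ hN hT hec heb s
    obtain ⟨ha1, ha2, -, hJa, -⟩ := expClass_facts hω hl hβ hγ hN hT hac hab s
    obtain ⟨-, -, hJi, hJ0, -⟩ := evolve_totalCurrentObs_facts hω hl hβ hγ hN hT 0
    haveI : IsMarkovKernel (P.transitionKernel N T T s.toNNReal) :=
      pinnedChain_isMarkovKernel_transitionKernel hω hl.le hβ.le hγ.le N T T _
    have hJ0' : ∫ z, totalCurrentObs P N z ∂(P.gibbsMeasure N T) = 0 := by
      have e : evolve P N T (totalCurrentObs P N) 0 = totalCurrentObs P N :=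
        funext fun z => pinnedChain_evolve_of_nonpos hω hl.le hβ.le hγ.le N T _ le_rfl z
      rw [e] at hJ0; exact hJ0
    have hJi' : Integrable (totalCurrentObs P N) (P.gibbsMeasure N T) := by
      have e : evolve P N T (totalCurrentObs P N) 0 = totalCurrentObs P N :=
        funext fun z => pinnedChain_evolve_of_nonpos hω hl.le hβ.le hγ.le N T _ le_rfl z
      rw [e] at hJi; exact hJi
    -- `κ_s ℓ₀ = −κ_s a₀ + γ T − 2γ κ_s e₀` pointwise
    have hℓ_eq : ∀ y, ℓ₀ y = -a₀ y + γ * T - 2 * γ * e₀ y := by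
      intro y
      rw [hℓ₀]
      dsimp only
      rw [LinearResponseFTUR.generator_kinetic P T T ⟨0, hN⟩ y, if_pos rfl, if_neg (by simp; omega)]
      show -(y.2 ⟨0, hN⟩ * partialQ ⟨0, hN⟩ (P.hamiltonian N) y) + γ * (T - y.2 ⟨0, hN⟩ ^ 2 + 0) = _
      rw [ha₀, he₀]
      ring
    have hpt : ∀ z, ∫ y, ℓ₀ y ∂(P.transitionKernel N T T s.toNNReal z) =
        -evolve P N T a₀ s z + γ * T - 2 * γ * evolve P N T e₀ s z := by
      intro z
      have i3 : Integrable (fun y => -a₀ y) (P.transitionKernel N T T s.toNNReal z) := (ha1 z).neg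
      have i4 : Integrable (fun _ : PhaseSpace N => γ * T) (P.transitionKernel N T T s.toNNReal z) := integrable_const _
      have i1 : Integrable (fun y => -a₀ y + γ * T) (P.transitionKernel N T T s.toNNReal z) := i3.add i4
      have i2 : Integrable (fun y => 2 * γ * e₀ y) (P.transitionKernel N T T s.toNNReal z) := (he1 z).const_mul _
      rw [evolve_def, evolve_def, integral_congr_ae (Eventually.of_forall hℓ_eq), integral_sub i1 i2,
        integral_add i3 i4]
      simp only [integral_neg, integral_const_mul, integral_const, smul_eq_mul, hP]
      simp
    rw [integral_congr_ae (Eventually.of_forall fun z => congrArg (fun w => totalCurrentObs P N z * w) (hpt z))]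
    have e3 : ∀ z, totalCurrentObs P N z * (-evolve P N T a₀ s z + γ * T - 2 * γ * evolve P N T e₀ s z) =
        -(totalCurrentObs P N z * evolve P N T a₀ s z) + γ * T * totalCurrentObs P N z -
          2 * γ * (totalCurrentObs P N z * evolve P N T e₀ s z) := fun z => by ring
    have j1 : Integrable (fun z => -(totalCurrentObs P N z * evolve P N T a₀ s z)) (P.gibbsMeasure N T) := hJa.neg
    have j2 : Integrable (fun z => γ * T * totalCurrentObs P N z) (P.gibbsMeasure N T) := hJi'.const_mul _
    have j3 : Integrable (fun z => 2 * γ * (totalCurrentObs P N z * evolve P N T e₀ s z)) (P.gibbsMeasure N T) :=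
      hJe.const_mul _
    have hodd : ∀ z : PhaseSpace N, a₀ (z.1, -z.2) = -a₀ z := by
      intro z
      rw [ha₀]
      dsimp only
      rw [show partialQ ⟨0, hN⟩ (P.hamiltonian N) (z.1, -z.2) = partialQ ⟨0, hN⟩ (P.hamiltonian N) z by
        rw [P.partialQ_hamiltonian_eq, P.partialQ_hamiltonian_eq]]
      simp only [Pi.neg_apply]
      ring
    have hdbo := integral_odd_mul_evolve_totalCurrentObs hω hl hβ hγ hN hT hac.measurable hodd ha2 s
    have j12 : Integrable (fun z => -(totalCurrentObs P N z * evolve P N T a₀ s z) + γ * T * totalCurrentObs P N z)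
        (P.gibbsMeasure N T) := j1.add j2
    rw [integral_congr_ae (Eventually.of_forall e3), integral_sub j12 j3, integral_add j1 j2]
    simp only [integral_neg, integral_const_mul, hJ0', mul_zero, add_zero]
    rw [hdbo]
  -- assemble
  have H' : (∫ z, totalCurrentObs P N z * evolve P N T e₀ r z ∂(P.gibbsMeasure N T)) -
      ∫ z, totalCurrentObs P N z * e₀ z ∂(P.gibbsMeasure N T) =
      ∫ s in (0:ℝ)..r, ∫ z, totalCurrentObs P N z * (∫ y, ℓ₀ y ∂(P.transitionKernel N T T s.toNNReal z))
        ∂(P.gibbsMeasure N T) := H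
  rw [hpar, sub_zero] at H'
  rw [H']
  exact intervalIntegral.integral_congr fun s _ => hint s

end Pinned

/-- **Registered helper `helper_kdKineticPairingDynkin` (stub S, line `kick-dipole-no-collapse`): THE DAMPED INTEGRAL EQUATION
OF THE KICK PAIRING.**  For the pinned anharmonic chain (all parameters `> 0`), `T > 0`, `N ≥ 2` and `r ≥ 0`: the kick-response
kernel is `𝒥_N(r) = −(2γ/T²) ψ(r)` with `ψ(r) = ∫ J · κ_r(p_0²/2) dμ_T`, and `ψ` solves
`ψ(r) = ∫₀ʳ (−Φ_N(s) − 2γ ψ(s)) ds` with the contact power pairing `Φ_N(s) = ∫ (p_0 ∂_{q_0}H) · (κ_s J) dμ_T`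
(`kickKernel_eq_pairing_kin`, `pairing_kin_dynkin`). -/
theorem helper_kdKineticPairingDynkin : ∀ ω₂ lam β γ : ℝ, 0 < ω₂ → 0 < lam → 0 < β → 0 < γ → ∀ T : ℝ, 0 < T → ∀ (N : ℕ) (hN : 2 ≤ N) (r : ℝ), 0 ≤ r → kickKernel (pinnedChain ω₂ lam β γ) N T r = -(2 * γ / T ^ 2) * ∫ z, totalCurrentObs (pinnedChain ω₂ lam β γ) N z * evolve (pinnedChain ω₂ lam β γ) N T (fun y : PhaseSpace N => y.2 ⟨0, by omega⟩ ^ 2 / 2) r z ∂((pinnedChain ω₂ lam β γ).gibbsMeasure N T) ∧ ∫ z, totalCurrentObs (pinnedChain ω₂ lam β γ) N z * evolve (pinnedChain ω₂ lam β γ) N T (fun y : PhaseSpace N => y.2 ⟨0, by omega⟩ ^ 2 / 2) r z ∂((pinnedChain ω₂ lam β γ).gibbsMeasure N T) = ∫ s in (0:ℝ)..r, (-(∫ z, (z.2 ⟨0, by omega⟩ * partialQ ⟨0, by omega⟩ ((pinnedChain ω₂ lam β γ).hamiltonian N) z) * evolve (pinnedChain ω₂ lam β γ) N T (totalCurrentObs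 (pinnedChain ω₂ lam β γ) N) s z ∂((pinnedChain ω₂ lam β γ).gibbsMeasure N T)) - 2 * γ * ∫ z, totalCurrentObs (pinnedChain ω₂ lam β γ) N z * evolve (pinnedChain ω₂ lam β γ) N T (fun y : PhaseSpace N => y.2 ⟨0, by omega⟩ ^ 2 / 2) s z ∂((pinnedChain ω₂ lam β γ).gibbsMeasure N T)) := by
  intro ω₂ lam β γ hω hl hβ hγ T hT N hN2 r hr
  have hN : 0 < N := by omega
  exact ⟨kickKernel_eq_pairing_kin hω hl hβ hγ hN hT r, pairing_kin_dynkin hω hl hβ hγ hN hT hN2 hr⟩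

end Summit.AtomisticToContinuum.FouriersLaw.Cruxes.ConductanceLowerBound.KickDipoleNoCollapse

end
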